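import Summits.QuantumFields.YangMills.Theorems.FluctuationComparisonRegPrIntLS1aCellMapChartReadSubmersion
import Summits.QuantumFields.YangMills.Theorems.FluctuationComparisonRegPrIntLS1aSubmersionDensityFibreAE
import Literature.MathematicalPhysics.QuantumFieldTheory.Balaban1983to89.BlockAveragingCentralBlind
import HarnessLib

/-!
# `FluctuationComparisonRegPrIntLS1aCellMapLocalFace` — THE ENGINE-FORM FLAT LOCAL FACE OF THE CELL MAP OF ONE UNCUT (0.4) STEP AT EVERY CONFIGURATION OF THE CLOSED CELL,
# MODULO THE CHART-SIDE NULL TRACES OF THE CELL BOUNDARIES (F4-c)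

Cell `ym3-torus` (HUMAN RULING D-0037: rung R3 = continuum SU(2) Yang–Mills on T³ — NOT d = 4, NOT infinite volume, NOT a mass gap, NOT Clay), WIDTH COPY «width 17»
of ym3-torus-p1, seat `ym3-torus-px17` gen 21; `--kind proof --supports stmt-QuantumFields-20520 --as helper` (count-neutral).  THEOREMS ONLY (no `def`, no `sorry`,
no `instance`, no `notation`, default heartbeats).  FILE (F5b) of the seat's 12:58Z INTENT (S1aᴴ `RunClassMembershipH` conjunct (c) at the ANCHOR heights, local-face road
on the FULL guard).

WHAT.  For the cell map `cell_s(U)(c) = (if c ∈ s then E (loopHol U c) else 1)·U(c)` of ✓`…S1aCellMapExtendedAverage` (`E` a measurable extended average, `= eml` on and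
continuous on the `1∕2`-guard) and EVERY configuration `U₀` whose `s`-families lie in the `1∕2`-guard (every point of the CLOSED cell `C̄_s`), the chart reading
`ψ(A) = Λ(cell(Θ^B(A)·U₀)(c)·cell(U₀)(c)⁻¹)` carries at `0` the FLAT LOCAL FACE in the engine form of lit ✓`Node00.RegSetOfLocalFaces.exists_continuous_density_SUN_of_flatLocalFaces'`
(exemption predicate `Q U :≡ ∀ c i, dist1 (loopHol U c i) ≠ δ`, i.e. «`U` on no cell boundary»): open `O ∋ 0`, `D ∋ 0` such that every measurable bounded `r ≥ 0` vanishing off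
`O` and continuous at each `A` with `A ∈ O → Q(Θ^B(A)·U₀)` has a push-forward density under `ψ` w.r.t. `⊗η` that is CONTINUOUS ON `D` — PROVIDED the two chart-side null
traces (F4-c) hold at `U₀` (hypotheses `hNullE`, `hNullI`: for every block `c` and every coarse value `v`, the `⊗_{non-private} η`-measure of the window configurations whose
`c`-fibre over `v` meets the `c`-boundary vanishes; EML branch for `c ∈ s`, identity branch for `c ∉ s`; delivered by px20 g22's `…S1aChartSideNullTraces` over ✓p824672 ∕
✓`…S1aGuardSphereNull`).

HOW.  ✓p823765 `exists_continuousOn_density_map_of_submersion_fibreAE'` with `μE = ⊗_{B} η`, `μY = ⊗_{B′} η`, `μK = ⊗_{NP} η` (`NP` = the non-private bonds), `M = ψ`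
(`C¹` at `0`: (F5a) A ✓`contDiffAt_chartRead_cellMap`; onto derivative and transversality: (F5a) C ✓`range_fderiv_chartRead_cellMap_eq_top`,
✓`isCompl_ker_fderiv_chartRead_cellMap_ker_restrictNonPrivate`), fibre coordinate `π A := (A b)_{b ∈ NP}`; the engine's exemption predicate is taken `Q′ x :≡ x ∈ O₀ → Q(Θ^B(x)·U₀)`
for a window `O₀ ∋ 0` on which (i) the `s`-families stay in the `1∕2`-guard, (ii) `‖ρ(cell(Θ^B x·U₀)(c)·cell(U₀)(c)⁻¹) − 1‖ < r_𝔠` (so `Λ` inverts `exp` and `ψ x = y` pins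
`cell(Θ^B x·U₀)(c) = Θ(y c)·cell(U₀)(c)` EXACTLY), (iii) `‖x_b‖ < s_𝔠`; the face window is `O := O_eng ∩ O₀`.  The engine's null-trace hypothesis then reduces — by the fibre
identities of ✓p824404 (`fibreFamily U c (U c) = loopHol U c`, the cell map's `c`-component) and the CYLINDER property of the boundary slices (they read `U` only through
`openHol U c`, blind to EVERY private bond: lit ✓`BlockAveragingCentralBlind`) transported along `x ↦ ext(π x)` — to the finite union over `c` of the two (F4-c) null sets.

CONTENT (namespace `Summit.QuantumFields.YangMills.Theorems.FluctuationComparisonRegPrIntLS1aCellMapLocalFace`).  §1 `fibreFamily_extend_centralBond`, `fibreFamily_congr_offPrivate`,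
`chartRead_cellMap_zero`, `eventually_cellMap_close`, `cellMap_eq_of_chartRead_eq`; §2 ★★`pi_traceSet_eq_zero` (the null-trace reduction); §3 ★★★`localFace_cellMap`.

HONEST FRAMING.  Measure-theoretic bookkeeping over (F5a), ✓p823765, ✓p824404 and lit `BlockAveragingCentralBlind`; the two (F4-c) null traces are HYPOTHESES of the face
(discharged by px20 g22's file, not here); nothing of Bałaban's analysis is asserted or proved; S1aᴴ (c) at the anchor heights NOT closed by this file ((F6) glue + sum over
cells, (F7) induction remain); (m), (a), S1aᴴ, the five registered stubs, crux 20520 ∕ 19936 ∕ 19200 and `YM3TorusSU2` NOT proved; rung R3 = SU(2) YM₃ on T³ — NOT d = 4,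
NOT infinite volume, NOT a mass gap, NOT Clay; the Yang–Mills mass gap is NOT proved.
References: [Balaban1987RG1] CMP 109 (1987) (0.4) p. 253, (0.13) p. 254; [EvansGariepy1992] §3.4.3 Thm 2; [Helgason2000] Ch. I §1 Thm. 1.14.
-/

set_option autoImplicit false

noncomputable section

open scoped Matrix.Norms.L2Operator Topology ENNReal Matrix
open Filter Set Function MeasureTheory

namespace Summit.QuantumFields.YangMills.Theorems.FluctuationComparisonRegPrIntLS1aCellMapLocalFace

open Literature.MathematicalPhysics.QuantumFieldTheory.Balaban1983to89
open Literature.MathematicalPhysics.QuantumFieldTheory.Balaban1983to89.HaarExponentialChart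
open Literature.MathematicalPhysics.QuantumFieldTheory.Balaban1983to89.HaarExponentialChart.IsChartRep
open Literature.MathematicalPhysics.QuantumFieldTheory.Balaban1983to89.BlockAveraging (Small Idx avgFun loopHol)
open Literature.MathematicalPhysics.QuantumFieldTheory.Balaban1983to89.BlockAveragingHaarAC (centralBond IsCentral openHol pre post centralBond_injective)
open Literature.MathematicalPhysics.QuantumFieldTheory.Balaban1983to89.BlockAveragingEMLHaarAC (fibreFamily fibreFamily_of_isCentral fibreFamily_of_not_isCentral)
open Literature.MathematicalPhysics.QuantumFieldTheory.Balaban1983to89.BlockAveragingCentralBlind (openHol_extend_centralBond)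
open Literature.MathematicalPhysics.QuantumFieldTheory.Balaban1983to89.ExpMeanLog (expMeanLogSU deltaSU eml)
open Literature.MathematicalPhysics.QuantumFieldTheory.Balaban1983to89.Node00 (SU)
open Literature.MathematicalPhysics.QuantumLattice (fundamentalRep fundamentalRep_apply continuous_fundamentalRep)
open Summit.QuantumFields.YangMills.BalabanUVNodes.N09ChartReadAveragingSmooth (piExpChart_translate_zero)
open Summit.QuantumFields.YangMills.Theorems.FluctuationComparisonRegPrIntLS1aCellMapExtendedAverage
open Summit.QuantumFields.YangMills.Theorems.FluctuationComparisonRegPrIntLS1aCellMapChartRead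
open Summit.QuantumFields.YangMills.Theorems.FluctuationComparisonRegPrIntLS1aSubmersionDensityFibreAE

variable {P : Params} {j : ℕ}
variable (E : (Idx P → SU 2) → SU 2) (s : Finset (PBond P (j + 1))) (U₀ : GaugeField P j (SU 2))

/-! ## §1 Bookkeeping: cylinder transfer, the chart reading at `0`, the closeness window, exact pinning of the coarse value -/

section Bookkeeping

/-- THE BOUNDARY SLICES ARE CYLINDERS: `fibreFamily` is blind to EVERY private bond (`extend` form; lit ✓`BlockAveragingCentralBlind.openHol_extend_centralBond`).
[cite: Balaban1987RG1, (0.4) p.253 (bookkeeping)] -/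
theorem fibreFamily_extend_centralBond (hj : j + 1 ≤ P.m + P.K) (U : GaugeField P j (SU 2)) (c : PBond P (j + 1)) (g : PBond P (j + 1) → SU 2) (W : SU 2) :
    fibreFamily (Function.extend centralBond g U) c W = fibreFamily U c W := by
  funext i
  by_cases hi : IsCentral c i
  · rw [fibreFamily_of_isCentral _ _ _ _ hi, fibreFamily_of_isCentral _ _ _ _ hi]
  · rw [fibreFamily_of_not_isCentral _ _ _ _ hi, fibreFamily_of_not_isCentral _ _ _ _ hi, openHol_extend_centralBond hj U c i hi g]

/-- …hence two configurations agreeing OFF the private bonds have the same fibre families. [cite: Balaban1987RG1, (0.4) p.253 (bookkeeping)] -/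
theorem fibreFamily_congr_offPrivate (hj : j + 1 ≤ P.m + P.K) {U U' : GaugeField P j (SU 2)}
    (h : ∀ b, (∀ c' : PBond P (j + 1), b ≠ centralBond c') → U b = U' b) (c : PBond P (j + 1)) (W : SU 2) :
    fibreFamily U' c W = fibreFamily U c W := by
  have hU' : U' = Function.extend centralBond (fun c' => U' (centralBond c')) U := by
    funext b
    by_cases hb : ∃ c' : PBond P (j + 1), centralBond c' = b
    · obtain ⟨c', rfl⟩ := hb
      rw [(centralBond_injective hj).extend_apply]
    · rw [Function.extend_apply' _ _ _ hb]
      push Not at hb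
      exact (h b fun c' hc' => hb c' hc'.symm).symm
  rw [hU']
  exact fibreFamily_extend_centralBond hj U c _ W

/-- THE CHART READING VANISHES AT `0` (`Θ^B(0)·U₀ = U₀`, `Λ 1 = 0`). [cite: Helgason2000, Ch. I §1 Thm. 1.14 (13) p. 96] -/
theorem chartRead_cellMap_zero :
    (fun (c : PBond P (j + 1)) => (isChartRep_specialUnitaryGroup (n := Fin 2)).logChart
        ((if c ∈ s then E (loopHol (fun b => (isChartRep_specialUnitaryGroup (n := Fin 2)).expChart
            ((0 : PBond P j → (specialUnitaryLogChart (Fin 2)).lie) b) * U₀ b) c) else 1) *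
            AveragingRT.axialAvg (fun b => (isChartRep_specialUnitaryGroup (n := Fin 2)).expChart
              ((0 : PBond P j → (specialUnitaryLogChart (Fin 2)).lie) b) * U₀ b) c *
          ((if c ∈ s then E (loopHol U₀ c) else 1) * AveragingRT.axialAvg U₀ c)⁻¹)) = 0 := by
  funext c
  rw [piExpChart_translate_zero, mul_inv_cancel, ← (isChartRep_specialUnitaryGroup (n := Fin 2)).expChart_zero,
    (isChartRep_specialUnitaryGroup (n := Fin 2)).logChart_expChart (by rw [norm_zero]; exact chartRadius_pos)]
  rfl

/-- THE CLOSENESS WINDOW: near `0` every component of `cell(Θ^B(x)·U₀)·cell(U₀)⁻¹` is within the inner radius of `1` (continuity of the cell map at `U₀`, ✓`continuousAt_cellMap`).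
[cite: Balaban1987RG1, (0.4) p.253 (bookkeeping)] -/
theorem eventually_cellMap_close
    (hEc : ContinuousOn E {W | ∀ i, ‖((W i : SU 2) : Matrix (Fin 2) (Fin 2) ℂ) - 1‖ < 1 / 2})
    (hwin : ∀ c ∈ s, ∀ i, ‖((loopHol U₀ c i : SU 2) : Matrix (Fin 2) (Fin 2) ℂ) - 1‖ < 1 / 2) :
    ∀ᶠ x in 𝓝 (0 : PBond P j → (specialUnitaryLogChart (Fin 2)).lie), ∀ c : PBond P (j + 1),
      ‖fundamentalRep (Fin 2) ((if c ∈ s then E (loopHol (fun b => (isChartRep_specialUnitaryGroup (n := Fin 2)).expChart (x b) * U₀ b) c) else 1) *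
            AveragingRT.axialAvg (fun b => (isChartRep_specialUnitaryGroup (n := Fin 2)).expChart (x b) * U₀ b) c *
          ((if c ∈ s then E (loopHol U₀ c) else 1) * AveragingRT.axialAvg U₀ c)⁻¹) - 1‖ < innerRadius (specialUnitaryLogChart (Fin 2)) := by
  have hΘ : Continuous fun (x : PBond P j → (specialUnitaryLogChart (Fin 2)).lie) (b : PBond P j) =>
      (isChartRep_specialUnitaryGroup (n := Fin 2)).expChart (x b) * U₀ b :=
    continuous_pi fun b => ((isChartRep_specialUnitaryGroup (n := Fin 2)).continuous_expChart.comp (continuous_apply b)).mul continuous_const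
  have hΘ0 : (fun (b : PBond P j) => (isChartRep_specialUnitaryGroup (n := Fin 2)).expChart ((0 : PBond P j → (specialUnitaryLogChart (Fin 2)).lie) b) * U₀ b) = U₀ :=
    piExpChart_translate_zero (P := P) (j := j) U₀
  have hcell := continuousAt_cellMap E s hEc hwin
  have h1 : ContinuousAt (fun x : PBond P j → (specialUnitaryLogChart (Fin 2)).lie =>
      (fun c => (if c ∈ s then E (loopHol (fun b => (isChartRep_specialUnitaryGroup (n := Fin 2)).expChart (x b) * U₀ b) c) else 1) *
        AveragingRT.axialAvg (fun b => (isChartRep_specialUnitaryGroup (n := Fin 2)).expChart (x b) * U₀ b) c)) 0 := by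
    refine ContinuousAt.comp (g := fun U : GaugeField P j (SU 2) => fun c => (if c ∈ s then E (loopHol U c) else 1) * AveragingRT.axialAvg U c)
      (f := fun (x : PBond P j → (specialUnitaryLogChart (Fin 2)).lie) (b : PBond P j) =>
      (isChartRep_specialUnitaryGroup (n := Fin 2)).expChart (x b) * U₀ b) (x := 0) ?_ hΘ.continuousAt
    rw [hΘ0]; exact hcell
  have hF : Continuous fun g : SU 2 => ‖fundamentalRep (Fin 2) g - 1‖ := continuous_norm.comp ((continuous_fundamentalRep (n := Fin 2)).sub continuous_const)
  refine eventually_all.2 fun c => ?_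
  have h2 : ContinuousAt (fun x : PBond P j → (specialUnitaryLogChart (Fin 2)).lie =>
      (if c ∈ s then E (loopHol (fun b => (isChartRep_specialUnitaryGroup (n := Fin 2)).expChart (x b) * U₀ b) c) else 1) *
          AveragingRT.axialAvg (fun b => (isChartRep_specialUnitaryGroup (n := Fin 2)).expChart (x b) * U₀ b) c *
        ((if c ∈ s then E (loopHol U₀ c) else 1) * AveragingRT.axialAvg U₀ c)⁻¹) 0 :=
    ((continuous_apply c).continuousAt.comp h1).mul continuousAt_const
  have h3 := ContinuousAt.comp (f := fun x : PBond P j → (specialUnitaryLogChart (Fin 2)).lie =>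
      (if c ∈ s then E (loopHol (fun b => (isChartRep_specialUnitaryGroup (n := Fin 2)).expChart (x b) * U₀ b) c) else 1) *
          AveragingRT.axialAvg (fun b => (isChartRep_specialUnitaryGroup (n := Fin 2)).expChart (x b) * U₀ b) c *
        ((if c ∈ s then E (loopHol U₀ c) else 1) * AveragingRT.axialAvg U₀ c)⁻¹) (x := (0 : PBond P j → (specialUnitaryLogChart (Fin 2)).lie))
    hF.continuousAt h2
  refine h3.eventually (isOpen_Iio.mem_nhds ?_)
  show ‖fundamentalRep (Fin 2) ((if c ∈ s then E (loopHol (fun b => (isChartRep_specialUnitaryGroup (n := Fin 2)).expChart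
      ((0 : PBond P j → (specialUnitaryLogChart (Fin 2)).lie) b) * U₀ b) c) else 1) *
        AveragingRT.axialAvg (fun b => (isChartRep_specialUnitaryGroup (n := Fin 2)).expChart ((0 : PBond P j → (specialUnitaryLogChart (Fin 2)).lie) b) * U₀ b) c *
      ((if c ∈ s then E (loopHol U₀ c) else 1) * AveragingRT.axialAvg U₀ c)⁻¹) - 1‖ < _
  rw [hΘ0, mul_inv_cancel, map_one, sub_self, norm_zero]
  exact innerRadius_pos

/-- EXACT PINNING OF THE COARSE VALUE: inside the closeness window `Λ` inverts `exp`, so `ψ x c = y c` gives `cell(Θ^B x·U₀)(c) = Θ(y c)·cell(U₀)(c)` exactly.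
[cite: Helgason2000, Ch. I §1 Thm. 1.14 (13) p. 96] -/
theorem cellMap_eq_of_chartRead_eq {g g₀ : SU 2} {yc : (specialUnitaryLogChart (Fin 2)).lie}
    (hclose : ‖fundamentalRep (Fin 2) (g * g₀⁻¹) - 1‖ < innerRadius (specialUnitaryLogChart (Fin 2)))
    (hψ : (isChartRep_specialUnitaryGroup (n := Fin 2)).logChart (g * g₀⁻¹) = yc) :
    g = (isChartRep_specialUnitaryGroup (n := Fin 2)).expChart yc * g₀ := by
  have h := (isChartRep_specialUnitaryGroup (n := Fin 2)).expChart_logChart hclose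
  rw [hψ] at h
  rw [h, inv_mul_cancel_right]

/-- The fibre identity at the configuration itself: `fibreFamily U c (U(c)) = loopHol U c` and `cell(U)(c) = (if c ∈ s then E (loopHol U c) else 1)·U(c)` with `U(c) = axialAvg U c`.
[cite: Balaban1987RG1, (0.4) p.253 (bookkeeping)] -/
theorem fibreFamily_axialAvg (U : GaugeField P j (SU 2)) (c : PBond P (j + 1)) :
    fibreFamily U c (AveragingRT.axialAvg U c) = loopHol U c :=
  (fibre_basePoint (P := P) (j := j) U c).2

end Bookkeeping

/-! ## §2 The null-trace reduction: the engine's exceptional fibre traces lie in the finite union of the (F4-c) null sets -/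

section Traces

variable [MeasurableSpace (specialUnitaryLogChart (Fin 2)).lie] (η : Measure (specialUnitaryLogChart (Fin 2)).lie)

/-- ★★ **THE NULL-TRACE REDUCTION.**  On a window `O₀` where the `s`-families stay in the `1∕2`-guard, the cell map stays within the inner radius of its base value and the
coordinates are `< s_𝔠`, the set of non-private coordinates `k` of configurations `x ∈ O₀` ON A CELL BOUNDARY with chart reading `ψ x = y` is `⊗_{NP} η`-null — it lies in the
finite union over the blocks `c` of the two (F4-c) null sets at the coarse values `v_c = Θ(y c)·cell(U₀)(c)` (EML branch for `c ∈ s`, identity branch for `c ∉ s`), by exact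
pinning, the fibre identity `fibreFamily U c (U c) = loopHol U c` and the cylinder property. [cite: Balaban1987RG1, (0.4) p.253; EvansGariepy1992, §3.4.3 (bookkeeping)] -/
theorem pi_traceSet_eq_zero (hj : j + 1 ≤ P.m + P.K) {O₀ : Set (PBond P j → (specialUnitaryLogChart (Fin 2)).lie)}
    (hO₀win : ∀ x ∈ O₀, ∀ c ∈ s, ∀ i, ‖((loopHol (fun b => (isChartRep_specialUnitaryGroup (n := Fin 2)).expChart (x b) * U₀ b) c i : SU 2) :
      Matrix (Fin 2) (Fin 2) ℂ) - 1‖ < 1 / 2)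
    (hO₀close : ∀ x ∈ O₀, ∀ c : PBond P (j + 1),
      ‖fundamentalRep (Fin 2) ((if c ∈ s then E (loopHol (fun b => (isChartRep_specialUnitaryGroup (n := Fin 2)).expChart (x b) * U₀ b) c) else 1) *
            AveragingRT.axialAvg (fun b => (isChartRep_specialUnitaryGroup (n := Fin 2)).expChart (x b) * U₀ b) c *
          ((if c ∈ s then E (loopHol U₀ c) else 1) * AveragingRT.axialAvg U₀ c)⁻¹) - 1‖ < innerRadius (specialUnitaryLogChart (Fin 2)))
    (hO₀ball : ∀ x ∈ O₀, ∀ b, x b ∈ Metric.ball (0 : (specialUnitaryLogChart (Fin 2)).lie) (chartRadius (specialUnitaryLogChart (Fin 2))))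
    (hNullE : ∀ c ∈ s, ∀ v : SU 2, Measure.pi (fun _ : {b : PBond P j // ∀ c' : PBond P (j + 1), b ≠ centralBond c'} => η)
      {k | (∀ b, k b ∈ Metric.ball (0 : (specialUnitaryLogChart (Fin 2)).lie) (chartRadius (specialUnitaryLogChart (Fin 2)))) ∧
        ∃ W : SU 2,
          (∀ i, dist1 (fibreFamily (fun b : PBond P j => (isChartRep_specialUnitaryGroup (n := Fin 2)).expChart (Function.extend Subtype.val k 0 b) * U₀ b) c W i) < 1 / 2) ∧
          (∃ i, dist1 (fibreFamily (fun b : PBond P j => (isChartRep_specialUnitaryGroup (n := Fin 2)).expChart (Function.extend Subtype.val k 0 b) * U₀ b) c W i) =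
            deltaSU (Fin 2)) ∧
          E (fibreFamily (fun b : PBond P j => (isChartRep_specialUnitaryGroup (n := Fin 2)).expChart (Function.extend Subtype.val k 0 b) * U₀ b) c W) * W = v} = 0)
    (hNullI : ∀ c, c ∉ s → ∀ v : SU 2, Measure.pi (fun _ : {b : PBond P j // ∀ c' : PBond P (j + 1), b ≠ centralBond c'} => η)
      {k | (∀ b, k b ∈ Metric.ball (0 : (specialUnitaryLogChart (Fin 2)).lie) (chartRadius (specialUnitaryLogChart (Fin 2)))) ∧
        ∃ i, dist1 (fibreFamily (fun b : PBond P j => (isChartRep_specialUnitaryGroup (n := Fin 2)).expChart (Function.extend Subtype.val k 0 b) * U₀ b) c v i) =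
          deltaSU (Fin 2)} = 0)
    (Oe : Set (PBond P j → (specialUnitaryLogChart (Fin 2)).lie)) (y : PBond P (j + 1) → (specialUnitaryLogChart (Fin 2)).lie) :
    Measure.pi (fun _ : {b : PBond P j // ∀ c' : PBond P (j + 1), b ≠ centralBond c'} => η)
      {k | ∃ x : PBond P j → (specialUnitaryLogChart (Fin 2)).lie, x ∈ Oe ∧
        ¬ (x ∈ O₀ → ∀ (c : PBond P (j + 1)) (i : Idx P),
            dist1 (loopHol (fun b => (isChartRep_specialUnitaryGroup (n := Fin 2)).expChart (x b) * U₀ b) c i) ≠ deltaSU (Fin 2)) ∧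
        (fun (c : PBond P (j + 1)) => (isChartRep_specialUnitaryGroup (n := Fin 2)).logChart
          ((if c ∈ s then E (loopHol (fun b => (isChartRep_specialUnitaryGroup (n := Fin 2)).expChart (x b) * U₀ b) c) else 1) *
              AveragingRT.axialAvg (fun b => (isChartRep_specialUnitaryGroup (n := Fin 2)).expChart (x b) * U₀ b) c *
            ((if c ∈ s then E (loopHol U₀ c) else 1) * AveragingRT.axialAvg U₀ c)⁻¹)) = y ∧
        (fun b : {b : PBond P j // ∀ c' : PBond P (j + 1), b ≠ centralBond c'} => x (b : PBond P j)) = k} = 0 := by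
  classical
  -- the coarse values pinned by `y`
  set v : PBond P (j + 1) → SU 2 := fun c => (isChartRep_specialUnitaryGroup (n := Fin 2)).expChart (y c) *
    ((if c ∈ s then E (loopHol U₀ c) else 1) * AveragingRT.axialAvg U₀ c) with hv
  -- the two families of (F4-c) sets, guarded by `c ∈ s` / `c ∉ s`
  set NE : PBond P (j + 1) → Set ({b : PBond P j // ∀ c' : PBond P (j + 1), b ≠ centralBond c'} → (specialUnitaryLogChart (Fin 2)).lie) := fun c =>
    {k | c ∈ s ∧ ((∀ b, k b ∈ Metric.ball (0 : (specialUnitaryLogChart (Fin 2)).lie) (chartRadius (specialUnitaryLogChart (Fin 2)))) ∧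
        ∃ W : SU 2,
          (∀ i, dist1 (fibreFamily (fun b : PBond P j => (isChartRep_specialUnitaryGroup (n := Fin 2)).expChart (Function.extend Subtype.val k 0 b) * U₀ b) c W i) < 1 / 2) ∧
          (∃ i, dist1 (fibreFamily (fun b : PBond P j => (isChartRep_specialUnitaryGroup (n := Fin 2)).expChart (Function.extend Subtype.val k 0 b) * U₀ b) c W i) =
            deltaSU (Fin 2)) ∧
          E (fibreFamily (fun b : PBond P j => (isChartRep_specialUnitaryGroup (n := Fin 2)).expChart (Function.extend Subtype.val k 0 b) * U₀ b) c W) * W = v c)} with hNE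
  set NI : PBond P (j + 1) → Set ({b : PBond P j // ∀ c' : PBond P (j + 1), b ≠ centralBond c'} → (specialUnitaryLogChart (Fin 2)).lie) := fun c =>
    {k | c ∉ s ∧ ((∀ b, k b ∈ Metric.ball (0 : (specialUnitaryLogChart (Fin 2)).lie) (chartRadius (specialUnitaryLogChart (Fin 2)))) ∧
        ∃ i, dist1 (fibreFamily (fun b : PBond P j => (isChartRep_specialUnitaryGroup (n := Fin 2)).expChart (Function.extend Subtype.val k 0 b) * U₀ b) c (v c) i) =
          deltaSU (Fin 2))} with hNI
  have hNEnull : ∀ c, Measure.pi (fun _ : {b : PBond P j // ∀ c' : PBond P (j + 1), b ≠ centralBond c'} => η) (NE c) = 0 := by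
    intro c
    by_cases hc : c ∈ s
    · refine measure_mono_null (fun k hk => hk.2) (hNullE c hc (v c))
    · have : NE c = ∅ := Set.eq_empty_of_forall_notMem fun k hk => hc hk.1
      rw [this, measure_empty]
  have hNInull : ∀ c, Measure.pi (fun _ : {b : PBond P j // ∀ c' : PBond P (j + 1), b ≠ centralBond c'} => η) (NI c) = 0 := by
    intro c
    by_cases hc : c ∈ s
    · have : NI c = ∅ := Set.eq_empty_of_forall_notMem fun k hk => hk.1 hc
      rw [this, measure_empty]
    · refine measure_mono_null (fun k hk => hk.2) (hNullI c hc (v c))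
  refine measure_mono_null (fun k hk => ?_) (measure_union_null (measure_iUnion_null hNEnull) (measure_iUnion_null hNInull))
  obtain ⟨x, -, hnQ, hψ, hπ⟩ := hk
  push Not at hnQ
  obtain ⟨hxO₀, c, i, hci⟩ := hnQ
  -- the configuration, its non-private refilling, and their agreement off the private bonds
  have hagree : ∀ b, (∀ c' : PBond P (j + 1), b ≠ centralBond c') →
      (fun b => (isChartRep_specialUnitaryGroup (n := Fin 2)).expChart (x b) * U₀ b) b =
        (fun b : PBond P j => (isChartRep_specialUnitaryGroup (n := Fin 2)).expChart (Function.extend Subtype.val k 0 b) * U₀ b) b := by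
    intro b hb
    have hext : Function.extend Subtype.val k 0 b = x b := by
      rw [← hπ]; exact Subtype.val_injective.extend_apply _ _ (⟨b, hb⟩ : {b : PBond P j // ∀ c' : PBond P (j + 1), b ≠ centralBond c'})
    simp only [hext]
  have hball : ∀ b : {b : PBond P j // ∀ c' : PBond P (j + 1), b ≠ centralBond c'},
      k b ∈ Metric.ball (0 : (specialUnitaryLogChart (Fin 2)).lie) (chartRadius (specialUnitaryLogChart (Fin 2))) := by
    intro b; rw [← hπ]; exact hO₀ball x hxO₀ b
  -- exact pinning of the `c`-th coarse value
  have hpin : (if c ∈ s then E (loopHol (fun b => (isChartRep_specialUnitaryGroup (n := Fin 2)).expChart (x b) * U₀ b) c) else 1) *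
      AveragingRT.axialAvg (fun b => (isChartRep_specialUnitaryGroup (n := Fin 2)).expChart (x b) * U₀ b) c = v c :=
    cellMap_eq_of_chartRead_eq (hO₀close x hxO₀ c) (congr_fun hψ c)
  have hff := fibreFamily_congr_offPrivate (P := P) (j := j) hj hagree c
  refine Set.mem_union _ _ _ |>.2 ?_
  by_cases hc : c ∈ s
  · refine Or.inl (Set.mem_iUnion.2 ⟨c, hc, hball, AveragingRT.axialAvg (fun b => (isChartRep_specialUnitaryGroup (n := Fin 2)).expChart (x b) * U₀ b) c, ?_, ?_, ?_⟩)
    · intro i'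
      rw [hff, fibreFamily_axialAvg]
      exact hO₀win x hxO₀ c hc i'
    · exact ⟨i, by rw [hff, fibreFamily_axialAvg]; exact hci⟩
    · rw [hff, fibreFamily_axialAvg, ← hpin, if_pos hc]
  · refine Or.inr (Set.mem_iUnion.2 ⟨c, hc, hball, i, ?_⟩)
    have hv' : v c = AveragingRT.axialAvg (fun b => (isChartRep_specialUnitaryGroup (n := Fin 2)).expChart (x b) * U₀ b) c := by
      rw [← hpin, if_neg hc, one_mul]
    rw [hff, hv', fibreFamily_axialAvg]
    exact hci

end Traces

/-! ## §3 The engine-form flat local face of the cell map at every configuration of the closed cell -/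

section Face

variable [MeasurableSpace (specialUnitaryLogChart (Fin 2)).lie] [BorelSpace (specialUnitaryLogChart (Fin 2)).lie]
  (η : Measure (specialUnitaryLogChart (Fin 2)).lie) [η.IsAddHaarMeasure]

/-- ★★★ **THE ENGINE-FORM FLAT LOCAL FACE OF THE CELL MAP OF ONE UNCUT (0.4) STEP, AT EVERY CONFIGURATION WHOSE `s`-FAMILIES LIE IN THE `1∕2`-GUARD, MODULO THE TWO
CHART-SIDE NULL TRACES (F4-c).**  `E` a measurable extended average, `= eml` on and continuous on the `1∕2`-guard (✓`exists_extendedAverage`); `U₀` with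
`‖loopHol U₀ c i − 1‖ < 1∕2` for `c ∈ s`; `hNullE ∕ hNullI` the (F4-c) null traces at `U₀`.  THEN there are open `O ∋ 0`, `D ∋ 0` in the bond-wise charts such that every
measurable bounded `r ≥ 0` vanishing off `O` and continuous at each `A` with `A ∈ O → (Θ^B(A)·U₀ on no cell boundary)` has under the chart reading `ψ` of the cell map a
push-forward density w.r.t. `⊗η` that is CONTINUOUS ON `D` — the `hface` clause of lit ✓`Node00.RegSetOfLocalFaces.exists_continuous_density_SUN_of_flatLocalFaces'` for
`M := cell_s`, `Q U :≡ ∀ c i, dist1 (loopHol U c i) ≠ δ`.  Engine: ✓p823765' with `μK = ⊗_{NP} η`, `π` = restriction to the non-private bonds, (F5a) A + C for the three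
binders, window `O := O_eng ∩ O₀`, exemption `Q′ x :≡ x ∈ O₀ → Q(Θ^B x·U₀)`, null traces by §2. [cite: Balaban1987RG1, (0.4) p.253, (0.13) p.254; EvansGariepy1992, §3.4.3 Thm 2] -/
theorem localFace_cellMap (hj : j + 1 ≤ P.m + P.K) (hEm : Measurable E)
    (hEeml : ∀ W, (∀ i, ‖((W i : SU 2) : Matrix (Fin 2) (Fin 2) ℂ) - 1‖ < 1 / 2) →
      ((E W : SU 2) : Matrix (Fin 2) (Fin 2) ℂ) = eml fun i => ((W i : SU 2) : Matrix (Fin 2) (Fin 2) ℂ))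
    (hEc : ContinuousOn E {W | ∀ i, ‖((W i : SU 2) : Matrix (Fin 2) (Fin 2) ℂ) - 1‖ < 1 / 2})
    (hwin : ∀ c ∈ s, ∀ i, ‖((loopHol U₀ c i : SU 2) : Matrix (Fin 2) (Fin 2) ℂ) - 1‖ < 1 / 2)
    (hNullE : ∀ c ∈ s, ∀ v : SU 2, Measure.pi (fun _ : {b : PBond P j // ∀ c' : PBond P (j + 1), b ≠ centralBond c'} => η)
      {k | (∀ b, k b ∈ Metric.ball (0 : (specialUnitaryLogChart (Fin 2)).lie) (chartRadius (specialUnitaryLogChart (Fin 2)))) ∧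
        ∃ W : SU 2,
          (∀ i, dist1 (fibreFamily (fun b : PBond P j => (isChartRep_specialUnitaryGroup (n := Fin 2)).expChart (Function.extend Subtype.val k 0 b) * U₀ b) c W i) < 1 / 2) ∧
          (∃ i, dist1 (fibreFamily (fun b : PBond P j => (isChartRep_specialUnitaryGroup (n := Fin 2)).expChart (Function.extend Subtype.val k 0 b) * U₀ b) c W i) =
            deltaSU (Fin 2)) ∧
          E (fibreFamily (fun b : PBond P j => (isChartRep_specialUnitaryGroup (n := Fin 2)).expChart (Function.extend Subtype.val k 0 b) * U₀ b) c W) * W = v} = 0)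
    (hNullI : ∀ c, c ∉ s → ∀ v : SU 2, Measure.pi (fun _ : {b : PBond P j // ∀ c' : PBond P (j + 1), b ≠ centralBond c'} => η)
      {k | (∀ b, k b ∈ Metric.ball (0 : (specialUnitaryLogChart (Fin 2)).lie) (chartRadius (specialUnitaryLogChart (Fin 2)))) ∧
        ∃ i, dist1 (fibreFamily (fun b : PBond P j => (isChartRep_specialUnitaryGroup (n := Fin 2)).expChart (Function.extend Subtype.val k 0 b) * U₀ b) c v i) =
          deltaSU (Fin 2)} = 0) :
    ∃ O : Set (PBond P j → (specialUnitaryLogChart (Fin 2)).lie), ∃ D : Set (PBond P (j + 1) → (specialUnitaryLogChart (Fin 2)).lie),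
      IsOpen O ∧ (0 : PBond P j → (specialUnitaryLogChart (Fin 2)).lie) ∈ O ∧ IsOpen D ∧ (0 : PBond P (j + 1) → (specialUnitaryLogChart (Fin 2)).lie) ∈ D ∧
      ∀ r : (PBond P j → (specialUnitaryLogChart (Fin 2)).lie) → ℝ, Measurable r → (∀ A, 0 ≤ r A) →
        (∀ A, (A ∈ O → ∀ (c : PBond P (j + 1)) (i : Idx P),
            dist1 (loopHol (fun b => (isChartRep_specialUnitaryGroup (n := Fin 2)).expChart (A b) * U₀ b) c i) ≠ deltaSU (Fin 2)) → ContinuousAt r A) →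
        (∃ C₀ : ℝ, ∀ A, r A ≤ C₀) → (∀ A, A ∉ O → r A = 0) →
        ∃ I : (PBond P (j + 1) → (specialUnitaryLogChart (Fin 2)).lie) → ℝ, ContinuousOn I D ∧ (∀ w, 0 ≤ I w) ∧
          ∀ A' : Set (PBond P (j + 1) → (specialUnitaryLogChart (Fin 2)).lie), MeasurableSet A' → A' ⊆ D →
            ((Measure.pi fun _ : PBond P j => η).withDensity fun A => ENNReal.ofReal (r A))
                ((fun (A : PBond P j → (specialUnitaryLogChart (Fin 2)).lie) (c : PBond P (j + 1)) =>
                  (isChartRep_specialUnitaryGroup (n := Fin 2)).logChart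
                    ((if c ∈ s then E (loopHol (fun b => (isChartRep_specialUnitaryGroup (n := Fin 2)).expChart (A b) * U₀ b) c) else 1) *
                        AveragingRT.axialAvg (fun b => (isChartRep_specialUnitaryGroup (n := Fin 2)).expChart (A b) * U₀ b) c *
                      ((if c ∈ s then E (loopHol U₀ c) else 1) * AveragingRT.axialAvg U₀ c)⁻¹)) ⁻¹' A') =
              ∫⁻ w in A', ENNReal.ofReal (I w) ∂(Measure.pi fun _ : PBond P (j + 1) => η) := by
  haveI : (Measure.pi fun _ : PBond P j => η).IsAddHaarMeasure := Measure.pi.isAddHaarMeasure _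
  haveI : (Measure.pi fun _ : PBond P (j + 1) => η).IsAddHaarMeasure := Measure.pi.isAddHaarMeasure _
  haveI : (Measure.pi fun _ : {b : PBond P j // ∀ c' : PBond P (j + 1), b ≠ centralBond c'} => η).IsAddHaarMeasure := Measure.pi.isAddHaarMeasure _
  -- the engine ✓p823765' with the non-private bonds as fibre coordinate
  have hM := (contDiffAt_chartRead_cellMap (P := P) (j := j) E s U₀ hEeml hwin).of_le (m := 1) le_top
  have hMm := measurable_chartRead_cellMap (P := P) (j := j) E s U₀ hEm
  obtain ⟨Oe, hOe, h0Oe, De, hDe, h0De, H⟩ := exists_continuousOn_density_map_of_submersion_fibreAE'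
    (Measure.pi fun _ : PBond P j => η) (Measure.pi fun _ : PBond P (j + 1) => η)
    (Measure.pi fun _ : {b : PBond P j // ∀ c' : PBond P (j + 1), b ≠ centralBond c'} => η) hMm hM
    (range_fderiv_chartRead_cellMap_eq_top E s U₀ hj hEeml hwin)
    (ContinuousLinearMap.pi fun b : {b : PBond P j // ∀ c' : PBond P (j + 1), b ≠ centralBond c'} =>
      (ContinuousLinearMap.proj (R := ℝ) (φ := fun _ : PBond P j => (specialUnitaryLogChart (Fin 2)).lie) (b : PBond P j)))
    (range_restrictNonPrivate_eq_top (P := P) (j := j)) (isCompl_ker_fderiv_chartRead_cellMap_ker_restrictNonPrivate E s U₀ hj hEeml hwin)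
  -- the window `O₀`: guard, closeness, chart radius
  obtain ⟨O₀, hO₀sub, hO₀o, h0O₀⟩ : ∃ O₀ : Set (PBond P j → (specialUnitaryLogChart (Fin 2)).lie),
      O₀ ⊆ {x | (∀ c ∈ s, ∀ i, ‖((loopHol (fun b => (isChartRep_specialUnitaryGroup (n := Fin 2)).expChart (x b) * U₀ b) c i : SU 2) :
          Matrix (Fin 2) (Fin 2) ℂ) - 1‖ < 1 / 2) ∧
        (∀ c : PBond P (j + 1), ‖fundamentalRep (Fin 2) ((if c ∈ s then E (loopHol (fun b => (isChartRep_specialUnitaryGroup (n := Fin 2)).expChart (x b) * U₀ b) c) else 1) *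
            AveragingRT.axialAvg (fun b => (isChartRep_specialUnitaryGroup (n := Fin 2)).expChart (x b) * U₀ b) c *
          ((if c ∈ s then E (loopHol U₀ c) else 1) * AveragingRT.axialAvg U₀ c)⁻¹) - 1‖ < innerRadius (specialUnitaryLogChart (Fin 2))) ∧
        ∀ b, x b ∈ Metric.ball (0 : (specialUnitaryLogChart (Fin 2)).lie) (chartRadius (specialUnitaryLogChart (Fin 2)))} ∧ IsOpen O₀ ∧ 0 ∈ O₀ := by
    have h1 := eventually_window_piExpChart_translate (P := P) (j := j) s U₀ hwin
    have h2 := eventually_cellMap_close (P := P) (j := j) E s U₀ hEc hwin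
    have h3 : ∀ᶠ x in 𝓝 (0 : PBond P j → (specialUnitaryLogChart (Fin 2)).lie),
        ∀ b, x b ∈ Metric.ball (0 : (specialUnitaryLogChart (Fin 2)).lie) (chartRadius (specialUnitaryLogChart (Fin 2))) := by
      have hpi : Set.pi Set.univ (fun _ : PBond P j => Metric.ball (0 : (specialUnitaryLogChart (Fin 2)).lie) (chartRadius (specialUnitaryLogChart (Fin 2)))) ∈
          𝓝 (0 : PBond P j → (specialUnitaryLogChart (Fin 2)).lie) :=
        set_pi_mem_nhds Set.finite_univ fun b _ => Metric.ball_mem_nhds _ chartRadius_pos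
      exact Filter.mem_of_superset hpi fun x hx b => hx b (Set.mem_univ b)
    obtain ⟨t, ht, hto, h0t⟩ := _root_.eventually_nhds_iff.1 (h1.and (h2.and h3))
    exact ⟨t, fun x hx => ht x hx, hto, h0t⟩
  have h0De' : (0 : PBond P (j + 1) → (specialUnitaryLogChart (Fin 2)).lie) ∈ De := by
    have h := h0De
    rwa [chartRead_cellMap_zero (P := P) (j := j) E s U₀] at h
  refine ⟨Oe ∩ O₀, De, hOe.inter hO₀o, ⟨h0Oe, h0O₀⟩, hDe, h0De', fun r hrm hr0 hrc hrC hrO => ?_⟩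
  obtain ⟨C₀, hC₀⟩ := hrC
  refine H (fun x => x ∈ O₀ → ∀ (c : PBond P (j + 1)) (i : Idx P),
      dist1 (loopHol (fun b => (isChartRep_specialUnitaryGroup (n := Fin 2)).expChart (x b) * U₀ b) c i) ≠ deltaSU (Fin 2))
    (fun y _ => pi_traceSet_eq_zero (P := P) (j := j) E s U₀ η hj (fun x hx => (hO₀sub hx).1) (fun x hx => (hO₀sub hx).2.1)
      (fun x hx => (hO₀sub hx).2.2) hNullE hNullI Oe y)
    r hrm hr0 (fun x hxOe hQ' => ?_) ⟨C₀, fun x _ => hC₀ x⟩ (fun x hx => hrO x fun h => hx h.1)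
  by_cases hxO₀ : x ∈ O₀
  · exact hrc x fun _ => hQ' hxO₀
  · exact hrc x fun hx => absurd hx.2 hxO₀

end Face


end Summit.QuantumFields.YangMills.Theorems.FluctuationComparisonRegPrIntLS1aCellMapLocalFace

end
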